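import Mathlib.Analysis.InnerProductSpace.Spectrum
import HarnessLib

/-!
# Ky Fan's principle for the two lowest eigenvalues of a closed form with compact embedding

Topic `Literature/Analysis/InnerProduct`, infinite-dimensional companion of `KyFanTwoSmallest.lean`
(Ky Fan for symmetric operators in finite dimension). Written as the abstract half of the min–max
step (§6, pp. 31–32 of arXiv:1801.01389) of [BoccatoEtAl2019Acta, Thm. 1.1] for the provefact
`Literature.MathematicalPhysics.QuantumManyBody.BoseGas.BoccatoEtAl2019Acta_firstExcitation`, whose
statement is the `m = 2` (Ky Fan) case of the min–max principle for the `N`-body Hamiltonian, written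
variationally over a form core.

**Setting.** A densely defined closed quadratic form `q ≥ -c` on a Hilbert space `H` is the same
thing as a Hilbert space `Q` (the form domain with `⟪φ, ψ⟫_Q = q(φ, ψ) + c⟪φ, ψ⟫_H`) together with an
injective bounded map `ι : Q →L[𝕜] H` [ReedSimonI1980, §VIII.6]. The associated
self-adjoint operator has compact resolvent iff `ι` is a compact operator [ReedSimonIV1978,
Thm. XIII.64]. We therefore work with an arbitrary `ι : Q →L[𝕜] H` between Hilbert spaces and its
**Gram operator** `T = ι†ι : Q →L[𝕜] Q` (`gramOp`): `⟪Tφ, ψ⟫_Q = ⟪ιφ, ιψ⟫_H`, `T` is self-adjoint,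
non-negative, `‖T‖ = ‖ι‖²`, compact when `ι` is, injective when `ι` is. An eigenvector
`Te = κe`, `κ > 0`, is exactly a weak eigenvector of the form: `⟪e, ψ⟫_Q = κ⁻¹⟪ιe, ιψ⟫_H` for all
`ψ ∈ Q`, i.e. `q(e, ·) = (κ⁻¹ - c)⟪ιe, ι·⟫_H`; the form eigenvalues are `μ = κ⁻¹ - c`, and the
LOWEST form eigenvalues correspond to the LARGEST eigenvalues of the compact operator `T`.

**Main results** (no named facts; two definitions: `gramOp` and the record `TwoModeData`).
* `exists_eigenvector_norm` — for compact `ι ≠ 0` the top of the spectrum `‖T‖` of `T` is attained: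
  there is a unit `e` with `Te = ‖T‖e` (Mathlib's Fredholm alternative
  `IsCompactOperator.hasEigenvalue_iff_mem_spectrum` and `rayleighQuotient_le_of_norm_mem_resolventSet`).
* `TwoModeData ι` — the spectral data of the two lowest form eigenvalues: unit `e₁ ⊥ e₂` in `Q`,
  `Te₁ = κ₁e₁`, `Te₂ = κ₂e₂`, `0 < κ₂ ≤ κ₁`, `‖ιψ‖² ≤ κ₁‖ψ‖²` for all `ψ` and `‖ιψ‖² ≤ κ₂‖ψ‖²` for
  `ψ ⊥ e₁`; `exists_twoModeData` constructs it (deflation to `(𝕜 ∙ e₁)ᗮ`) for compact injective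
  `ι` as soon as `ι(Q)` contains two non-zero orthogonal vectors.
* `TwoModeData.le_norm_sq` (`κ₁⁻¹ ≤ ‖ψ‖²_Q` for `‖ιψ‖ = 1`), `TwoModeData.le_norm_sq_of_inner_eq_zero`
  (`κ₂⁻¹ ≤ ‖ψ‖²_Q` for `‖ιψ‖ = 1`, `ιψ ⊥ ιe₁`) and **Ky Fan** `TwoModeData.kyFan_two_le`:
  `κ₁⁻¹ + κ₂⁻¹ ≤ ‖ψ₁‖²_Q + ‖ψ₂‖²_Q` whenever `ιψ₁, ιψ₂` are orthonormal in `H` — the proof is the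
  `m = 2` rearrangement of `KyFanTwoSmallest.sum_mul_ge_two_smallest` after splitting `ψᵢ` along
  `e₁` and using Bessel's inequality in `H` for the pair `ιψ₁, ιψ₂` against `ιe₁`;
* attainment `TwoModeData.kyFan_two_attained` at `φᵢ = κᵢ^{-1/2}eᵢ`, and the **form-core versions**
  `TwoModeData.exists_lt_of_dense`, `TwoModeData.exists_pair_lt_of_dense`, `TwoModeData.isGLB_of_dense`,
  `TwoModeData.isGLB_pair_of_dense`: over any dense subspace `S ⊆ Q` (a form core) the infimum of
  `‖ψ‖²_Q` over `‖ιψ‖ = 1`, resp. of `‖ψ₁‖²_Q + ‖ψ₂‖²_Q` over `H`-orthonormal pairs, is `κ₁⁻¹`, resp.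
  `κ₁⁻¹ + κ₂⁻¹` (Gram–Schmidt in the `H`-inner product is continuous on `Q`).
In the language of [ReedSimonIV1978, Thm. XIII.1–XIII.2] this is `μ₁ = inf q`, `μ₁ + μ₂ =
inf {q(ψ₁) + q(ψ₂) : ψ₁ ⊥ ψ₂ unit}` over any form core, with the infima attained at eigenvectors.
Higher `m` (the full min–max enumeration) is deliberately not developed here.

## References
* [BoccatoEtAl2019Acta] C. Boccato, C. Brennecke, S. Cenatiempo, B. Schlein, *Bogoliubov theory in the
  Gross–Pitaevskii limit*, Acta Math. 222 (2019), §6 (the min–max comparison, pp. 31–32 of arXiv:1801.01389).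
* [ReedSimonIV1978] M. Reed, B. Simon, *Methods of Modern Mathematical Physics IV*, Thm. XIII.1, XIII.2, XIII.64.
* [ReedSimonI1980] M. Reed, B. Simon, *Methods of Modern Mathematical Physics I*, §VIII.6 (quadratic forms).
* Ky Fan, Proc. Nat. Acad. Sci. USA 35 (1949) 652–655, Thm. 1.
-/

noncomputable section

open scoped InnerProductSpace
open RCLike ContinuousLinearMap Module.End Filter Set
open _root_.Topology

namespace Literature.Analysis.InnerProduct

variable {𝕜 : Type*} [RCLike 𝕜]
variable {Q H : Type*} [NormedAddCommGroup Q] [InnerProductSpace 𝕜 Q] [CompleteSpace Q]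
  [NormedAddCommGroup H] [InnerProductSpace 𝕜 H] [CompleteSpace H]

/-! ### The Gram operator `T = ι†ι` -/

/-- The **Gram operator** `T = ι† ∘ ι : Q → Q` of a bounded map `ι : Q → H` between Hilbert spaces:
`⟪Tφ, ψ⟫_Q = ⟪ιφ, ιψ⟫_H`. When `Q` is the domain of a closed form `q ≥ -c` on `H` with
`⟪·,·⟫_Q = q + c⟪·,·⟫_H` and `ι` the inclusion, `T` is the resolvent `(A + c)⁻¹` of the associated
operator read on the form domain. [folklore] -/
def gramOp (ι : Q →L[𝕜] H) : Q →L[𝕜] Q :=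
  (ContinuousLinearMap.adjoint ι) ∘L ι

variable (ι : Q →L[𝕜] H)

/-- `Tφ = ι†(ιφ)`. [folklore] -/
theorem gramOp_apply (x : Q) : gramOp ι x = ContinuousLinearMap.adjoint ι (ι x) := rfl

/-- `⟪Tφ, ψ⟫_Q = ⟪ιφ, ιψ⟫_H`. [folklore] -/
theorem inner_gramOp_left (x y : Q) : ⟪gramOp ι x, y⟫_𝕜 = ⟪ι x, ι y⟫_𝕜 := by
  rw [gramOp_apply, adjoint_inner_left]

/-- `⟪φ, Tψ⟫_Q = ⟪ιφ, ιψ⟫_H`. [folklore] -/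
theorem inner_gramOp_right (x y : Q) : ⟪x, gramOp ι y⟫_𝕜 = ⟪ι x, ι y⟫_𝕜 := by
  rw [gramOp_apply, adjoint_inner_right]

/-- `⟪Tφ, φ⟫_Q = ‖ιφ‖²`. [folklore] -/
theorem inner_gramOp_self (x : Q) : ⟪gramOp ι x, x⟫_𝕜 = ((‖ι x‖ ^ 2 : ℝ) : 𝕜) := by
  rw [inner_gramOp_left, inner_self_eq_norm_sq_to_K]; norm_cast

/-- `re ⟪Tφ, φ⟫_Q = ‖ιφ‖²` (`T ≥ 0`). [folklore] -/
theorem re_inner_gramOp_self (x : Q) : re ⟪gramOp ι x, x⟫_𝕜 = ‖ι x‖ ^ 2 := by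
  rw [inner_gramOp_self, ofReal_re]

/-- `T = ι†ι` is self-adjoint. [folklore] -/
theorem isSelfAdjoint_gramOp : IsSelfAdjoint (gramOp ι) := by
  rw [isSelfAdjoint_iff', gramOp, adjoint_comp, adjoint_adjoint]

/-- `T = ι†ι` is symmetric. [folklore] -/
theorem isSymmetric_gramOp : (gramOp ι : Q →ₗ[𝕜] Q).IsSymmetric :=
  (isSelfAdjoint_gramOp ι).isSymmetric

/-- `‖T‖ = ‖ι‖²`. [folklore] -/
theorem norm_gramOp : ‖gramOp ι‖ = ‖ι‖ * ‖ι‖ := norm_adjoint_comp_self ι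

/-- `T = 0 ↔ ι = 0`. [folklore] -/
theorem gramOp_eq_zero_iff : gramOp ι = 0 ↔ ι = 0 := adjoint_comp_self_eq_zero_iff

/-- `‖ιφ‖² ≤ ‖T‖ ‖φ‖²` (the top of the spectrum of `T` bounds the embedding). [folklore] -/
theorem norm_sq_le_norm_gramOp_mul (x : Q) : ‖ι x‖ ^ 2 ≤ ‖gramOp ι‖ * ‖x‖ ^ 2 := by
  calc ‖ι x‖ ^ 2 = re ⟪gramOp ι x, x⟫_𝕜 := (re_inner_gramOp_self ι x).symm
    _ ≤ ‖gramOp ι x‖ * ‖x‖ := re_inner_le_norm _ _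
    _ ≤ ‖gramOp ι‖ * ‖x‖ * ‖x‖ := by gcongr; exact le_opNorm _ _
    _ = ‖gramOp ι‖ * ‖x‖ ^ 2 := by ring

/-- `T = ι†ι` is compact when `ι` is. [folklore] -/
theorem isCompactOperator_gramOp (hι : IsCompactOperator ι) : IsCompactOperator (gramOp ι) :=
  hι.clm_comp (ContinuousLinearMap.adjoint ι)

/-- The Rayleigh quotient of `T = ι†ι` is non-negative. [folklore] -/
theorem rayleighQuotient_gramOp_nonneg (x : Q) : 0 ≤ (gramOp ι).rayleighQuotient x := by
  rw [rayleighQuotient, reApplyInnerSelf_apply, re_inner_gramOp_self]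
  positivity

/-- An eigenvector of `T` is a weak eigenvector of the form: `Te = κe` gives
`⟪ιe, ιψ⟫_H = κ⟪e, ψ⟫_Q` for every `ψ`. [folklore] -/
theorem inner_map_eq_of_gramOp_eq_smul {e : Q} {κ : ℝ} (he : gramOp ι e = (κ : 𝕜) • e) (y : Q) :
    ⟪ι e, ι y⟫_𝕜 = (κ : 𝕜) * ⟪e, y⟫_𝕜 := by
  rw [← inner_gramOp_left, he, inner_smul_left, conj_ofReal]

/-- For an eigenvector `Te = κe`: `‖ιe‖² = κ‖e‖²`. [folklore] -/
theorem norm_map_sq_of_gramOp_eq_smul {e : Q} {κ : ℝ} (he : gramOp ι e = (κ : 𝕜) • e) :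
    ‖ι e‖ ^ 2 = κ * ‖e‖ ^ 2 := by
  have h := inner_map_eq_of_gramOp_eq_smul ι he e
  rw [inner_self_eq_norm_sq_to_K, inner_self_eq_norm_sq_to_K] at h
  have h' : ((‖ι e‖ ^ 2 : ℝ) : 𝕜) = ((κ * ‖e‖ ^ 2 : ℝ) : 𝕜) := by push_cast; exact h
  exact RCLike.ofReal_injective h'

/-- **The top of the spectrum of `T = ι†ι` is an eigenvalue** when `ι ≠ 0` is compact: there is a
unit vector `e ∈ Q` with `Te = ‖T‖e`. (Fredholm alternative: the non-zero spectrum of a compact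
operator consists of eigenvalues, and `‖T‖ ∈ σ(T)` for `T ≥ 0` because `‖T‖ = sup` of the
Rayleigh quotient.) [folklore] -/
theorem exists_eigenvector_norm (hι : IsCompactOperator ι) (h0 : ι ≠ 0) :
    ∃ e : Q, ‖e‖ = 1 ∧ gramOp ι e = ((‖gramOp ι‖ : ℝ) : 𝕜) • e := by
  set T := gramOp ι with hT
  have hT0 : T ≠ 0 := fun h => h0 ((gramOp_eq_zero_iff ι).1 h)
  have hTn : ‖T‖ ≠ 0 := norm_ne_zero_iff.mpr hT0
  have _inst : Nontrivial Q := by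
    by_contra hQ
    rw [not_nontrivial_iff_subsingleton] at hQ
    exact hT0 (Subsingleton.elim _ _)
  -- `‖T‖` lies in the spectrum of `T`
  have hmem : ((‖T‖ : ℝ) : 𝕜) ∈ spectrum 𝕜 T := by
    by_contra hres
    have hres' : algebraMap ℝ 𝕜 ‖T‖ ∈ resolventSet 𝕜 T := by
      rw [spectrum.mem_resolventSet_iff]
      rwa [spectrum.mem_iff, not_not] at hres
    obtain ⟨ε, hε, hle⟩ := T.rayleighQuotient_le_of_norm_mem_resolventSet hres'
    have hsup := T.norm_eq_iSup_rayleighQuotient (isSymmetric_gramOp ι)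
    have : ‖T‖ ≤ ‖T‖ - ε := by
      refine hsup.le.trans (ciSup_le fun x => ?_)
      rw [abs_of_nonneg (rayleighQuotient_gramOp_nonneg ι x)]
      exact hle x
    linarith
  have hev : HasEigenvalue (T : Module.End 𝕜 Q) ((‖T‖ : ℝ) : 𝕜) :=
    (IsCompactOperator.hasEigenvalue_iff_mem_spectrum (isCompactOperator_gramOp ι hι)
      (RCLike.ofReal_ne_zero.2 hTn)).mpr hmem
  obtain ⟨v, hv⟩ := hev.exists_hasEigenvector
  have hv0 : v ≠ 0 := hv.2
  have hTv : T v = ((‖T‖ : ℝ) : 𝕜) • v := hv.apply_eq_smul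
  have hvn : ‖v‖ ≠ 0 := norm_ne_zero_iff.mpr hv0
  refine ⟨((‖v‖⁻¹ : ℝ) : 𝕜) • v, ?_, ?_⟩
  · rw [norm_smul, norm_ofReal, abs_of_nonneg (inv_nonneg.2 (norm_nonneg _)),
      inv_mul_cancel₀ hvn]
  · rw [map_smul, hTv, smul_comm]

/-! ### The two top eigenpairs of `T` (the two lowest form eigenvalues) -/

/-- **Spectral data for the two lowest eigenvalues of a form with compact embedding.** For
`ι : Q →L[𝕜] H` with Gram operator `T = ι†ι`: orthogonal unit vectors `e₁, e₂ ∈ Q` with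
`Te₁ = κ₁e₁`, `Te₂ = κ₂e₂`, `0 < κ₂ ≤ κ₁`, where `κ₁` bounds `T` (`‖ιψ‖² ≤ κ₁‖ψ‖²`) and `κ₂` bounds
`T` on `e₁^⊥` (`‖ιψ‖² ≤ κ₂‖ψ‖²` for `ψ ⊥ e₁`). In form language `μᵢ = κᵢ⁻¹ - c` are the two lowest
eigenvalues (with multiplicity) of the operator of the form and `eᵢ` are eigenvectors
[ReedSimonIV1978, Thm. XIII.1]. Constructed in `exists_twoModeData`. [folklore] -/
structure TwoModeData (ι : Q →L[𝕜] H) where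
  /-- a top eigenvector of `T`, `‖e₁‖_Q = 1` -/
  e₁ : Q
  /-- a top eigenvector of `T` on `e₁^⊥`, `‖e₂‖_Q = 1` -/
  e₂ : Q
  /-- the largest eigenvalue `κ₁ = ‖T‖` of `T` -/
  κ₁ : ℝ
  /-- the largest eigenvalue of `T` on `e₁^⊥` -/
  κ₂ : ℝ
  norm_e₁ : ‖e₁‖ = 1
  norm_e₂ : ‖e₂‖ = 1
  inner_e₁_e₂ : inner 𝕜 e₁ e₂ = 0
  κ₂_pos : 0 < κ₂
  κ₂_le_κ₁ : κ₂ ≤ κ₁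
  gramOp_e₁ : gramOp ι e₁ = (κ₁ : 𝕜) • e₁
  gramOp_e₂ : gramOp ι e₂ = (κ₂ : 𝕜) • e₂
  norm_sq_le_one : ∀ ψ : Q, ‖ι ψ‖ ^ 2 ≤ κ₁ * ‖ψ‖ ^ 2
  norm_sq_le_two : ∀ ψ : Q, inner 𝕜 e₁ ψ = 0 → ‖ι ψ‖ ^ 2 ≤ κ₂ * ‖ψ‖ ^ 2

/-- **Existence of the two top eigenpairs** of `T = ι†ι` for a compact `ι` whose range contains two
non-zero `H`-orthogonal vectors (for injective `ι`: `dim Q ≥ 2`): the top eigenvector `e₁`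
(`exists_eigenvector_norm`), then the top eigenvector of the compression of `T` to the invariant
subspace `(𝕜 ∙ e₁)ᗮ`, which is the Gram operator of `ι ∘ (𝕜 ∙ e₁)ᗮ.subtype`. Injectivity of `ι`
is not needed. [folklore] -/
theorem exists_twoModeData (hι : IsCompactOperator ι)
    (h2 : ∃ x y : Q, ⟪ι x, ι y⟫_𝕜 = 0 ∧ ι x ≠ 0 ∧ ι y ≠ 0) : Nonempty (TwoModeData ι) := by
  obtain ⟨x, y, hxy, hx, hy⟩ := h2
  have h0 : ι ≠ 0 := fun h => hx (by simp [h])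
  obtain ⟨e₁, he₁, hTe₁⟩ := exists_eigenvector_norm ι hι h0
  set κ₁ : ℝ := ‖gramOp ι‖ with hκ₁
  have hκ₁pos : 0 < κ₁ := norm_pos_iff.mpr fun h => h0 ((gramOp_eq_zero_iff ι).1 h)
  -- the invariant subspace `K = e₁^⊥` and the restricted embedding
  set K : Submodule 𝕜 Q := (𝕜 ∙ e₁)ᗮ with hK
  set ι₁ : K →L[𝕜] H := ι ∘L K.subtypeL with hι₁
  have hι₁c : IsCompactOperator ι₁ := hι.comp_clm K.subtypeL
  have hmemK : ∀ z : Q, z - ⟪e₁, z⟫_𝕜 • e₁ ∈ K := fun z => by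
    rw [hK, Submodule.mem_orthogonal_singleton_iff_inner_right, inner_sub_right, inner_smul_right,
      inner_self_eq_norm_sq_to_K, he₁]
    simp
  -- `K` contains a vector with non-zero image
  have hKne : ∃ k : K, ι₁ k ≠ 0 := by
    by_contra hall
    push Not at hall
    have hzero : ∀ z : Q, ι z = ⟪e₁, z⟫_𝕜 • ι e₁ := fun z => by
      have := hall ⟨_, hmemK z⟩
      simp only [hι₁, ContinuousLinearMap.comp_apply, Submodule.subtypeL_apply, map_sub,
        map_smul] at this
      exact (sub_eq_zero.1 this)
    have hιe₁ : ‖ι e₁‖ ^ 2 = κ₁ := by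
      rw [norm_map_sq_of_gramOp_eq_smul ι hTe₁, he₁]; ring
    have hιe₁' : ((‖ι e₁‖ : 𝕜)) ^ 2 = ((κ₁ : ℝ) : 𝕜) := by rw [← hιe₁]; push_cast; ring
    have hprod : ⟪ι x, ι y⟫_𝕜 = (starRingEnd 𝕜) ⟪e₁, x⟫_𝕜 * ⟪e₁, y⟫_𝕜 * ((κ₁ : ℝ) : 𝕜) := by
      rw [hzero x, hzero y, inner_smul_left, inner_smul_right, inner_self_eq_norm_sq_to_K, hιe₁']
      ring
    rw [hprod] at hxy
    rcases mul_eq_zero.1 hxy with h | h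
    · rcases mul_eq_zero.1 h with h' | h'
      · apply hx; rw [hzero x, (map_eq_zero (starRingEnd 𝕜)).1 h', zero_smul]
      · apply hy; rw [hzero y, h', zero_smul]
    · exact absurd (RCLike.ofReal_eq_zero.1 h) hκ₁pos.ne'
  obtain ⟨k₀, hk₀⟩ := hKne
  have h0₁ : ι₁ ≠ 0 := fun h => hk₀ (by simp [h])
  obtain ⟨f, hf, hTf⟩ := exists_eigenvector_norm ι₁ hι₁c h0₁
  set κ₂ : ℝ := ‖gramOp ι₁‖ with hκ₂
  have hκ₂pos : 0 < κ₂ := norm_pos_iff.mpr fun h => h0₁ ((gramOp_eq_zero_iff ι₁).1 h)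
  have hfK : ⟪e₁, (f : Q)⟫_𝕜 = 0 :=
    (Submodule.mem_orthogonal_singleton_iff_inner_right).1 f.2
  -- `T e₂ = κ₂ e₂` in `Q`
  have hιe₁_left : ∀ z : Q, ⟪ι z, ι e₁⟫_𝕜 = ((κ₁ : ℝ) : 𝕜) * ⟪z, e₁⟫_𝕜 := fun z => by
    rw [← inner_conj_symm, inner_map_eq_of_gramOp_eq_smul ι hTe₁ z, map_mul, conj_ofReal,
      inner_conj_symm]
  have hTf' : gramOp ι (f : Q) = ((κ₂ : ℝ) : 𝕜) • (f : Q) := by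
    refine ext_inner_right 𝕜 fun z => ?_
    have hz : z = ⟪e₁, z⟫_𝕜 • e₁ + (z - ⟪e₁, z⟫_𝕜 • e₁) := by abel
    rw [inner_gramOp_left, hz, map_add, inner_add_right, inner_add_right]
    congr 1
    · have hfe : ⟪(f : Q), e₁⟫_𝕜 = 0 := by rw [← inner_conj_symm, hfK, map_zero]
      rw [map_smul, inner_smul_right, inner_smul_right, hιe₁_left, inner_smul_left, hfe]
      simp
    · have h1 : ⟪ι (f : Q), ι (z - ⟪e₁, z⟫_𝕜 • e₁)⟫_𝕜 = ⟪ι₁ f, ι₁ ⟨_, hmemK z⟩⟫_𝕜 := rfl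
      rw [h1, ← inner_gramOp_left ι₁, hTf, inner_smul_left, conj_ofReal, Submodule.coe_inner,
        inner_smul_left, conj_ofReal]
  refine ⟨{
    e₁ := e₁, e₂ := (f : Q), κ₁ := κ₁, κ₂ := κ₂,
    norm_e₁ := he₁,
    norm_e₂ := by rw [Submodule.norm_coe]; exact hf,
    inner_e₁_e₂ := hfK,
    κ₂_pos := hκ₂pos,
    κ₂_le_κ₁ := ?_,
    gramOp_e₁ := hTe₁,
    gramOp_e₂ := hTf',
    norm_sq_le_one := norm_sq_le_norm_gramOp_mul ι,
    norm_sq_le_two := ?_ }⟩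
  · -- `κ₂ = ‖ι e₂‖² ≤ κ₁ ‖e₂‖² = κ₁`
    have h1 : ‖ι (f : Q)‖ ^ 2 = κ₂ := by
      rw [norm_map_sq_of_gramOp_eq_smul ι hTf', Submodule.norm_coe, hf]; ring
    have h2 := norm_sq_le_norm_gramOp_mul ι (f : Q)
    rw [h1, Submodule.norm_coe, hf] at h2
    simpa using h2
  · intro ψ hψ
    have hψK : ψ ∈ K := (Submodule.mem_orthogonal_singleton_iff_inner_right).2 hψ
    have := norm_sq_le_norm_gramOp_mul ι₁ ⟨ψ, hψK⟩
    simpa [hι₁] using this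

namespace TwoModeData

variable {ι}
variable (d : TwoModeData ι)

/-- `0 < κ₁`. [folklore] -/
theorem κ₁_pos : 0 < d.κ₁ := d.κ₂_pos.trans_le d.κ₂_le_κ₁

/-- `κ₁` is the top of the spectrum: `κ₁ = ‖T‖` (`κ₁ = ‖Te₁‖ ≤ ‖T‖`, and `‖T‖ = sup` of the
Rayleigh quotient `‖ιψ‖²/‖ψ‖² ≤ κ₁`). [folklore] -/
theorem κ₁_eq_norm_gramOp : d.κ₁ = ‖gramOp ι‖ := by
  refine le_antisymm ?_ ?_
  · have h := le_opNorm (gramOp ι) d.e₁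
    rw [d.gramOp_e₁, norm_smul, norm_ofReal, d.norm_e₁, mul_one, mul_one,
      abs_of_pos d.κ₁_pos] at h
    exact h
  · have _inst : Nonempty Q := ⟨d.e₁⟩
    rw [(gramOp ι).norm_eq_iSup_rayleighQuotient (isSymmetric_gramOp ι)]
    refine ciSup_le fun x => ?_
    rw [abs_of_nonneg (rayleighQuotient_gramOp_nonneg ι x), rayleighQuotient,
      reApplyInnerSelf_apply, re_inner_gramOp_self]
    by_cases hx : x = 0
    · simp [hx, d.κ₁_pos.le]
    · rw [div_le_iff₀ (by positivity)]
      exact d.norm_sq_le_one x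

/-- `‖ιe₁‖² = κ₁`. [folklore] -/
theorem norm_map_e₁_sq : ‖ι d.e₁‖ ^ 2 = d.κ₁ := by
  rw [norm_map_sq_of_gramOp_eq_smul ι d.gramOp_e₁, d.norm_e₁]; ring

/-- `‖ιe₂‖² = κ₂`. [folklore] -/
theorem norm_map_e₂_sq : ‖ι d.e₂‖ ^ 2 = d.κ₂ := by
  rw [norm_map_sq_of_gramOp_eq_smul ι d.gramOp_e₂, d.norm_e₂]; ring

/-- The weak eigen-equation of `e₁`: `⟪ιe₁, ιψ⟫_H = κ₁⟪e₁, ψ⟫_Q`. [folklore] -/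
theorem inner_map_e₁ (ψ : Q) : ⟪ι d.e₁, ι ψ⟫_𝕜 = (d.κ₁ : 𝕜) * ⟪d.e₁, ψ⟫_𝕜 :=
  inner_map_eq_of_gramOp_eq_smul ι d.gramOp_e₁ ψ

/-- The weak eigen-equation of `e₂`: `⟪ιe₂, ιψ⟫_H = κ₂⟪e₂, ψ⟫_Q`. [folklore] -/
theorem inner_map_e₂ (ψ : Q) : ⟪ι d.e₂, ι ψ⟫_𝕜 = (d.κ₂ : 𝕜) * ⟪d.e₂, ψ⟫_𝕜 :=
  inner_map_eq_of_gramOp_eq_smul ι d.gramOp_e₂ ψ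

/-- `ιe₁ ⊥ ιe₂` in `H`. [folklore] -/
theorem inner_map_e₁_map_e₂ : ⟪ι d.e₁, ι d.e₂⟫_𝕜 = 0 := by
  rw [d.inner_map_e₁, d.inner_e₁_e₂, mul_zero]

/-- `ψ ⊥ e₁` in `Q` iff `ιψ ⊥ ιe₁` in `H`. [folklore] -/
theorem inner_e₁_eq_zero_iff (ψ : Q) : ⟪d.e₁, ψ⟫_𝕜 = 0 ↔ ⟪ι d.e₁, ι ψ⟫_𝕜 = 0 := by
  rw [d.inner_map_e₁, mul_eq_zero, or_iff_right]
  exact_mod_cast d.κ₁_pos.ne'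

/-- **The lowest form eigenvalue bounds the form from below**: `κ₁⁻¹ ≤ ‖ψ‖²_Q` whenever
`‖ιψ‖_H = 1`. [folklore] -/
theorem le_norm_sq {ψ : Q} (hψ : ‖ι ψ‖ = 1) : d.κ₁⁻¹ ≤ ‖ψ‖ ^ 2 := by
  have h := d.norm_sq_le_one ψ
  rw [hψ, one_pow] at h
  rw [inv_le_iff_one_le_mul₀ d.κ₁_pos]
  linarith

/-- **The second form eigenvalue bounds the form on `e₁^⊥`**: `κ₂⁻¹ ≤ ‖ψ‖²_Q` whenever
`‖ιψ‖_H = 1` and `ιψ ⊥ ιe₁`. [folklore] -/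
theorem le_norm_sq_of_inner_eq_zero {ψ : Q} (hψ : ‖ι ψ‖ = 1) (horth : ⟪ι d.e₁, ι ψ⟫_𝕜 = 0) :
    d.κ₂⁻¹ ≤ ‖ψ‖ ^ 2 := by
  have h := d.norm_sq_le_two ψ ((d.inner_e₁_eq_zero_iff ψ).2 horth)
  rw [hψ, one_pow] at h
  rw [inv_le_iff_one_le_mul₀ d.κ₂_pos]
  linarith

omit [CompleteSpace H] in
/-- Bessel's inequality for an orthonormal pair: `‖⟪u₁, x⟫‖² + ‖⟪u₂, x⟫‖² ≤ ‖x‖²`. [folklore] -/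
theorem norm_inner_sq_add_le {u₁ u₂ : H} (h₁ : ‖u₁‖ = 1) (h₂ : ‖u₂‖ = 1) (h₁₂ : ⟪u₁, u₂⟫_𝕜 = 0)
    (x : H) : ‖⟪u₁, x⟫_𝕜‖ ^ 2 + ‖⟪u₂, x⟫_𝕜‖ ^ 2 ≤ ‖x‖ ^ 2 := by
  have hon : Orthonormal 𝕜 ![u₁, u₂] := by
    rw [orthonormal_iff_ite]
    intro i j
    fin_cases i <;> fin_cases j
    · simp [inner_self_eq_norm_sq_to_K, h₁]
    · simp [h₁₂]
    · simp [← inner_conj_symm u₂ u₁, h₁₂]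
    · simp [inner_self_eq_norm_sq_to_K, h₂]
  have := hon.sum_inner_products_le x (s := Finset.univ)
  simpa [Fin.sum_univ_two] using this

/-- **Ky Fan's principle, lower bound (`m = 2`).** If `ιψ₁, ιψ₂` are orthonormal in `H` then
`κ₁⁻¹ + κ₂⁻¹ ≤ ‖ψ₁‖²_Q + ‖ψ₂‖²_Q`: the sum of the two lowest form eigenvalues is a lower bound for
`q(ψ₁) + q(ψ₂)` over orthonormal pairs [ReedSimonIV1978, Thm. XIII.1–2; Ky Fan 1949, Thm. 1]. Proof:
split `ψᵢ = αᵢe₁ + ψᵢ'` with `ψᵢ' ⊥ e₁`; then `‖ψᵢ‖² = |αᵢ|² + ‖ψᵢ'‖²`,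
`1 = ‖ιψᵢ‖² = |αᵢ|²κ₁ + ‖ιψᵢ'‖²`, `‖ιψᵢ'‖² ≤ κ₂‖ψᵢ'‖²`, and Bessel in `H` against `ιe₁` gives
`κ₁(|α₁|² + |α₂|²) ≤ 1`; the rest is the rearrangement inequality. [folklore] -/
theorem kyFan_two_le {ψ₁ ψ₂ : Q} (h₁ : ‖ι ψ₁‖ = 1) (h₂ : ‖ι ψ₂‖ = 1) (h₁₂ : ⟪ι ψ₁, ι ψ₂⟫_𝕜 = 0) :
    d.κ₁⁻¹ + d.κ₂⁻¹ ≤ ‖ψ₁‖ ^ 2 + ‖ψ₂‖ ^ 2 := by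
  have hκ₁ := d.κ₁_pos
  have hκ₂ := d.κ₂_pos
  -- the splitting along `e₁`
  have key : ∀ ψ : Q, ‖ι ψ‖ = 1 →
      ‖ψ‖ ^ 2 = ‖⟪d.e₁, ψ⟫_𝕜‖ ^ 2 + ‖ψ - ⟪d.e₁, ψ⟫_𝕜 • d.e₁‖ ^ 2 ∧
      1 = ‖⟪d.e₁, ψ⟫_𝕜‖ ^ 2 * d.κ₁ + ‖ι (ψ - ⟪d.e₁, ψ⟫_𝕜 • d.e₁)‖ ^ 2 ∧
      ‖ι (ψ - ⟪d.e₁, ψ⟫_𝕜 • d.e₁)‖ ^ 2 ≤ d.κ₂ * ‖ψ - ⟪d.e₁, ψ⟫_𝕜 • d.e₁‖ ^ 2 := by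
    intro ψ hψ
    set a : 𝕜 := ⟪d.e₁, ψ⟫_𝕜 with ha
    set ψ' : Q := ψ - a • d.e₁ with hψ'
    have horth : ⟪d.e₁, ψ'⟫_𝕜 = 0 := by
      rw [hψ', inner_sub_right, inner_smul_right, inner_self_eq_norm_sq_to_K, d.norm_e₁]; simp [ha]
    have hdec : ψ = a • d.e₁ + ψ' := by rw [hψ']; abel
    refine ⟨?_, ?_, d.norm_sq_le_two ψ' horth⟩
    · have h0 : ⟪a • d.e₁, ψ'⟫_𝕜 = 0 := by rw [inner_smul_left, horth, mul_zero]
      have := norm_add_sq_eq_norm_sq_add_norm_sq_of_inner_eq_zero _ _ h0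
      rw [← hdec, norm_smul, d.norm_e₁, mul_one] at this
      simpa only [sq] using this
    · have h0 : ⟪ι (a • d.e₁), ι ψ'⟫_𝕜 = 0 := by
        rw [map_smul, inner_smul_left, d.inner_map_e₁, horth]; simp
      have := norm_add_sq_eq_norm_sq_add_norm_sq_of_inner_eq_zero _ _ h0
      rw [← map_add, ← hdec, hψ, map_smul, norm_smul] at this
      rw [← d.norm_map_e₁_sq]
      linear_combination this
  obtain ⟨hA₁, hB₁, hC₁⟩ := key ψ₁ h₁
  obtain ⟨hA₂, hB₂, hC₂⟩ := key ψ₂ h₂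
  -- Bessel in `H` for the pair `ιψ₁, ιψ₂` against `ιe₁`
  have hBessel : (‖⟪d.e₁, ψ₁⟫_𝕜‖ ^ 2 + ‖⟪d.e₁, ψ₂⟫_𝕜‖ ^ 2) * d.κ₁ ≤ 1 := by
    have hb := norm_inner_sq_add_le h₁ h₂ h₁₂ (ι d.e₁)
    have hi : ∀ ψ : Q, ‖⟪ι ψ, ι d.e₁⟫_𝕜‖ ^ 2 = ‖⟪d.e₁, ψ⟫_𝕜‖ ^ 2 * d.κ₁ ^ 2 := fun ψ => by
      have hcs : ⟪ι ψ, ι d.e₁⟫_𝕜 = (starRingEnd 𝕜) ⟪ι d.e₁, ι ψ⟫_𝕜 := (inner_conj_symm _ _).symm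
      rw [hcs, d.inner_map_e₁, map_mul, conj_ofReal, norm_mul, norm_ofReal, abs_of_pos hκ₁,
        RCLike.norm_conj]
      ring
    rw [hi, hi, d.norm_map_e₁_sq] at hb
    have : (‖⟪d.e₁, ψ₁⟫_𝕜‖ ^ 2 + ‖⟪d.e₁, ψ₂⟫_𝕜‖ ^ 2) * d.κ₁ * d.κ₁ ≤ 1 * d.κ₁ := by nlinarith
    exact le_of_mul_le_mul_right this hκ₁
  -- the rearrangement
  set A := ‖⟪d.e₁, ψ₁⟫_𝕜‖ ^ 2 + ‖⟪d.e₁, ψ₂⟫_𝕜‖ ^ 2 with hA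
  set X₁ := ‖ψ₁ - ⟪d.e₁, ψ₁⟫_𝕜 • d.e₁‖ ^ 2
  set X₂ := ‖ψ₂ - ⟪d.e₁, ψ₂⟫_𝕜 • d.e₁‖ ^ 2
  set Y₁ := ‖ι (ψ₁ - ⟪d.e₁, ψ₁⟫_𝕜 • d.e₁)‖ ^ 2
  set Y₂ := ‖ι (ψ₂ - ⟪d.e₁, ψ₂⟫_𝕜 • d.e₁)‖ ^ 2
  have hX : (2 - A * d.κ₁) ≤ d.κ₂ * (X₁ + X₂) := by nlinarith
  rw [hA₁, hA₂]
  have hgoal : d.κ₁⁻¹ + d.κ₂⁻¹ ≤ A + (2 - A * d.κ₁) / d.κ₂ := by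
    rw [div_eq_mul_inv, inv_eq_one_div, inv_eq_one_div]
    have h1 : 1 / d.κ₁ + 1 / d.κ₂ - (A + (2 - A * d.κ₁) * (1 / d.κ₂))
        = -((d.κ₁ - d.κ₂) * (1 - A * d.κ₁)) / (d.κ₁ * d.κ₂) := by
      field_simp
      ring
    have h2 : 0 ≤ (d.κ₁ - d.κ₂) * (1 - A * d.κ₁) :=
      mul_nonneg (sub_nonneg.2 d.κ₂_le_κ₁) (by nlinarith)
    have h3 : -((d.κ₁ - d.κ₂) * (1 - A * d.κ₁)) / (d.κ₁ * d.κ₂) ≤ 0 :=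
      div_nonpos_of_nonpos_of_nonneg (neg_nonpos.2 h2) (by positivity)
    linarith
  calc d.κ₁⁻¹ + d.κ₂⁻¹ ≤ A + (2 - A * d.κ₁) / d.κ₂ := hgoal
    _ ≤ A + (X₁ + X₂) := by
        have : (2 - A * d.κ₁) / d.κ₂ ≤ X₁ + X₂ := by rw [div_le_iff₀ hκ₂]; linarith
        linarith
    _ = ‖⟪d.e₁, ψ₁⟫_𝕜‖ ^ 2 + X₁ + (‖⟪d.e₁, ψ₂⟫_𝕜‖ ^ 2 + X₂) := by rw [hA]; ring

/-- The normalised first eigenvector `φ₁ = κ₁^{-1/2} e₁` (`‖ιφ₁‖_H = 1`). [folklore] -/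
def φ₁ : Q := (((Real.sqrt d.κ₁)⁻¹ : ℝ) : 𝕜) • d.e₁

/-- The normalised second eigenvector `φ₂ = κ₂^{-1/2} e₂` (`‖ιφ₂‖_H = 1`). [folklore] -/
def φ₂ : Q := (((Real.sqrt d.κ₂)⁻¹ : ℝ) : 𝕜) • d.e₂

/-- `‖ιφ₁‖ = 1`. [folklore] -/
theorem norm_map_φ₁ : ‖ι d.φ₁‖ = 1 := by
  have h := d.norm_map_e₁_sq
  have hs : Real.sqrt d.κ₁ ≠ 0 := (Real.sqrt_pos.2 d.κ₁_pos).ne'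
  have hn : ‖ι d.e₁‖ = Real.sqrt d.κ₁ := by rw [← h, Real.sqrt_sq (norm_nonneg _)]
  rw [φ₁, map_smul, norm_smul, norm_ofReal, abs_of_nonneg (inv_nonneg.2 (Real.sqrt_nonneg _)), hn,
    inv_mul_cancel₀ hs]

/-- `‖ιφ₂‖ = 1`. [folklore] -/
theorem norm_map_φ₂ : ‖ι d.φ₂‖ = 1 := by
  have h := d.norm_map_e₂_sq
  have hs : Real.sqrt d.κ₂ ≠ 0 := (Real.sqrt_pos.2 d.κ₂_pos).ne'
  have hn : ‖ι d.e₂‖ = Real.sqrt d.κ₂ := by rw [← h, Real.sqrt_sq (norm_nonneg _)]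
  rw [φ₂, map_smul, norm_smul, norm_ofReal, abs_of_nonneg (inv_nonneg.2 (Real.sqrt_nonneg _)), hn,
    inv_mul_cancel₀ hs]

/-- `ιφ₁ ⊥ ιφ₂`. [folklore] -/
theorem inner_map_φ₁_map_φ₂ : ⟪ι d.φ₁, ι d.φ₂⟫_𝕜 = 0 := by
  rw [φ₁, φ₂, map_smul, map_smul, inner_smul_left, inner_smul_right, d.inner_map_e₁_map_e₂]
  simp

/-- `‖φ₁‖²_Q = κ₁⁻¹`. [folklore] -/
theorem norm_φ₁_sq : ‖d.φ₁‖ ^ 2 = d.κ₁⁻¹ := by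
  rw [φ₁, norm_smul, norm_ofReal, d.norm_e₁, mul_one, abs_of_nonneg (inv_nonneg.2 (Real.sqrt_nonneg _)),
    inv_pow, Real.sq_sqrt d.κ₁_pos.le]

/-- `‖φ₂‖²_Q = κ₂⁻¹`. [folklore] -/
theorem norm_φ₂_sq : ‖d.φ₂‖ ^ 2 = d.κ₂⁻¹ := by
  rw [φ₂, norm_smul, norm_ofReal, d.norm_e₂, mul_one, abs_of_nonneg (inv_nonneg.2 (Real.sqrt_nonneg _)),
    inv_pow, Real.sq_sqrt d.κ₂_pos.le]

/-- **Ky Fan's principle, attainment (`m = 2`)**: the pair `φ₁, φ₂` of normalised eigenvectors is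
`H`-orthonormal and `‖φ₁‖²_Q + ‖φ₂‖²_Q = κ₁⁻¹ + κ₂⁻¹`. [folklore] -/
theorem kyFan_two_attained :
    ‖ι d.φ₁‖ = 1 ∧ ‖ι d.φ₂‖ = 1 ∧ ⟪ι d.φ₁, ι d.φ₂⟫_𝕜 = 0 ∧
      ‖d.φ₁‖ ^ 2 + ‖d.φ₂‖ ^ 2 = d.κ₁⁻¹ + d.κ₂⁻¹ :=
  ⟨d.norm_map_φ₁, d.norm_map_φ₂, d.inner_map_φ₁_map_φ₂, by rw [d.norm_φ₁_sq, d.norm_φ₂_sq]⟩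

/-- The lowest form eigenvalue is attained: `‖ιφ₁‖ = 1` and `‖φ₁‖²_Q = κ₁⁻¹`. [folklore] -/
theorem ground_attained : ‖ι d.φ₁‖ = 1 ∧ ‖d.φ₁‖ ^ 2 = d.κ₁⁻¹ :=
  ⟨d.norm_map_φ₁, d.norm_φ₁_sq⟩

end TwoModeData

/-! ### Form cores: the infima over a dense subspace of `Q` -/

/-- `H`-normalisation of a vector of `Q`: `ψ ↦ ‖ιψ‖⁻¹ψ`. [folklore] -/
def mapNormalize (s : Q) : Q := (((‖ι s‖)⁻¹ : ℝ) : 𝕜) • s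

omit [CompleteSpace Q] [CompleteSpace H] in
/-- `‖ι(‖ιψ‖⁻¹ψ)‖ = 1` for `ιψ ≠ 0`. [folklore] -/
theorem norm_map_mapNormalize {s : Q} (h : ι s ≠ 0) : ‖ι (mapNormalize ι s)‖ = 1 := by
  rw [mapNormalize, map_smul, norm_smul, norm_ofReal, abs_of_nonneg (inv_nonneg.2 (norm_nonneg _)),
    inv_mul_cancel₀ (norm_ne_zero_iff.2 h)]

omit [CompleteSpace Q] [CompleteSpace H] in
/-- Normalising an `H`-normalised vector does nothing. [folklore] -/
theorem mapNormalize_of_norm_eq_one {s : Q} (h : ‖ι s‖ = 1) : mapNormalize ι s = s := by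
  rw [mapNormalize, h, inv_one, ofReal_one, one_smul]

omit [CompleteSpace Q] [CompleteSpace H] in
/-- `H`-normalisation is continuous (for the topology of `Q`) at every `ψ` with `ιψ ≠ 0`. [folklore] -/
theorem continuousAt_mapNormalize {s₀ : Q} (h : ι s₀ ≠ 0) : ContinuousAt (mapNormalize ι) s₀ := by
  have h1 : ContinuousAt (fun s : Q => ((‖ι s‖)⁻¹ : ℝ)) s₀ :=
    (ι.continuous.norm.continuousAt).inv₀ (norm_ne_zero_iff.2 h)
  have h2 : ContinuousAt (fun s : Q => (((‖ι s‖)⁻¹ : ℝ) : 𝕜)) s₀ :=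
    (continuous_ofReal.continuousAt).comp h1
  exact h2.smul continuousAt_id

omit [CompleteSpace Q] [CompleteSpace H] in
/-- A subspace is stable under `H`-normalisation. [folklore] -/
theorem mapNormalize_mem {S : Submodule 𝕜 Q} {s : Q} (hs : s ∈ S) : mapNormalize ι s ∈ S :=
  S.smul_mem _ hs

namespace TwoModeData

variable {ι}
variable (d : TwoModeData ι)

/-- **The lowest form eigenvalue over a form core.** For every dense subspace `S ⊆ Q` and `ε > 0`
there is `ψ ∈ S` with `‖ιψ‖ = 1` and `‖ψ‖²_Q < κ₁⁻¹ + ε` (normalise elements of `S` close to the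
eigenvector `φ₁`). [folklore] -/
theorem exists_lt_of_dense {S : Submodule 𝕜 Q} (hS : Dense (S : Set Q)) {ε : ℝ} (hε : 0 < ε) :
    ∃ ψ ∈ S, ‖ι ψ‖ = 1 ∧ ‖ψ‖ ^ 2 < d.κ₁⁻¹ + ε := by
  have hφ : ι d.φ₁ ≠ 0 := by
    rw [← norm_ne_zero_iff, d.norm_map_φ₁]; exact one_ne_zero
  have hu : ContinuousAt (mapNormalize ι) d.φ₁ := continuousAt_mapNormalize ι hφ
  have hF : ContinuousAt (fun s => ‖mapNormalize ι s‖ ^ 2) d.φ₁ := (hu.norm).pow 2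
  have hG : ContinuousAt (fun s => ‖ι s‖) d.φ₁ := ι.continuous.norm.continuousAt
  have h1 : ∀ᶠ s in 𝓝 d.φ₁, ‖mapNormalize ι s‖ ^ 2 < d.κ₁⁻¹ + ε := by
    refine hF.eventually_lt_const ?_
    show ‖mapNormalize ι d.φ₁‖ ^ 2 < d.κ₁⁻¹ + ε
    rw [mapNormalize_of_norm_eq_one ι d.norm_map_φ₁, d.norm_φ₁_sq]
    linarith
  have h2 : ∀ᶠ s in 𝓝 d.φ₁, ι s ≠ 0 := by
    have hval : (1 / 2 : ℝ) < ‖ι d.φ₁‖ := by rw [d.norm_map_φ₁]; norm_num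
    have : ∀ᶠ s in 𝓝 d.φ₁, (1 / 2 : ℝ) < ‖ι s‖ := hG.eventually_const_lt hval
    refine this.mono fun s hs h0 => ?_
    rw [h0, norm_zero] at hs
    linarith
  obtain ⟨s, hsS, hs1, hs2⟩ := hS.inter_nhds_nonempty (h1.and h2)
  exact ⟨mapNormalize ι s, mapNormalize_mem ι hsS, norm_map_mapNormalize ι hs2, hs1⟩

/-- **The lowest form eigenvalue is the infimum of the form over any form core**:
`κ₁⁻¹ = inf {‖ψ‖²_Q : ψ ∈ S, ‖ιψ‖ = 1}` for every dense subspace `S ⊆ Q`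
[ReedSimonIV1978, Thm. XIII.1–2]. [folklore] -/
theorem isGLB_of_dense {S : Submodule 𝕜 Q} (hS : Dense (S : Set Q)) :
    IsGLB {r : ℝ | ∃ ψ ∈ S, ‖ι ψ‖ = 1 ∧ r = ‖ψ‖ ^ 2} d.κ₁⁻¹ := by
  refine ⟨?_, fun b hb => ?_⟩
  · rintro r ⟨ψ, -, hψ, rfl⟩
    exact d.le_norm_sq hψ
  · by_contra hlt
    push Not at hlt
    obtain ⟨ψ, hψS, hψ1, hlt'⟩ := d.exists_lt_of_dense hS (sub_pos.2 hlt)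
    have := hb ⟨ψ, hψS, hψ1, rfl⟩
    linarith

/-- The whole form domain: `κ₁⁻¹ = min {‖ψ‖²_Q : ‖ιψ‖ = 1}`, attained at `φ₁`. [folklore] -/
theorem isGLB_single :
    IsGLB {r : ℝ | ∃ ψ : Q, ‖ι ψ‖ = 1 ∧ r = ‖ψ‖ ^ 2} d.κ₁⁻¹ := by
  refine ⟨?_, fun b hb => ?_⟩
  · rintro r ⟨ψ, hψ, rfl⟩
    exact d.le_norm_sq hψ
  · exact hb ⟨d.φ₁, d.norm_map_φ₁, d.norm_φ₁_sq.symm⟩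

/-- **Ky Fan over a form core (`m = 2`).** For every dense subspace `S ⊆ Q` and `ε > 0` there are
`ψ₁, ψ₂ ∈ S` with `ιψ₁, ιψ₂` orthonormal in `H` and `‖ψ₁‖²_Q + ‖ψ₂‖²_Q < κ₁⁻¹ + κ₂⁻¹ + ε`:
Gram–Schmidt (in the `H`-inner product) applied to elements of `S × S` close to `(φ₁, φ₂)` in
`Q × Q`; all the operations are continuous there. [folklore] -/
theorem exists_pair_lt_of_dense {S : Submodule 𝕜 Q} (hS : Dense (S : Set Q)) {ε : ℝ} (hε : 0 < ε) :
    ∃ ψ₁ ∈ S, ∃ ψ₂ ∈ S, ‖ι ψ₁‖ = 1 ∧ ‖ι ψ₂‖ = 1 ∧ ⟪ι ψ₁, ι ψ₂⟫_𝕜 = 0 ∧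
      ‖ψ₁‖ ^ 2 + ‖ψ₂‖ ^ 2 < d.κ₁⁻¹ + d.κ₂⁻¹ + ε := by
  -- Gram–Schmidt in the `H`-inner product, as maps on `Q × Q`
  set u : Q × Q → Q := fun p => mapNormalize ι p.1 with hu_def
  set w : Q × Q → Q := fun p => p.2 - ⟪ι (u p), ι p.2⟫_𝕜 • u p with hw_def
  set v : Q × Q → Q := fun p => mapNormalize ι (w p) with hv_def
  have hφ₁ : ι d.φ₁ ≠ 0 := by
    rw [← norm_ne_zero_iff, d.norm_map_φ₁]; exact one_ne_zero
  have hφ₂ : ι d.φ₂ ≠ 0 := by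
    rw [← norm_ne_zero_iff, d.norm_map_φ₂]; exact one_ne_zero
  have hu₀ : u (d.φ₁, d.φ₂) = d.φ₁ := mapNormalize_of_norm_eq_one ι d.norm_map_φ₁
  have hw₀ : w (d.φ₁, d.φ₂) = d.φ₂ := by
    simp only [hw_def, hu₀, d.inner_map_φ₁_map_φ₂, zero_smul, sub_zero]
  have hv₀ : v (d.φ₁, d.φ₂) = d.φ₂ := by
    simp only [hv_def, hw₀]; exact mapNormalize_of_norm_eq_one ι d.norm_map_φ₂
  -- continuity at `(φ₁, φ₂)`
  have hu : ContinuousAt u (d.φ₁, d.φ₂) :=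
    (continuousAt_mapNormalize ι hφ₁).comp_of_eq continuousAt_fst rfl
  have hιu : ContinuousAt (fun p => ι (u p)) (d.φ₁, d.φ₂) :=
    ι.continuous.continuousAt.comp_of_eq hu rfl
  have hι2 : ContinuousAt (fun p : Q × Q => ι p.2) (d.φ₁, d.φ₂) :=
    ι.continuous.continuousAt.comp_of_eq continuousAt_snd rfl
  have hw : ContinuousAt w (d.φ₁, d.φ₂) := continuousAt_snd.sub ((hιu.inner hι2).smul hu)
  have hv : ContinuousAt v (d.φ₁, d.φ₂) :=
    (continuousAt_mapNormalize ι hφ₂).comp_of_eq hw hw₀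
  have hF : ContinuousAt (fun p => ‖u p‖ ^ 2 + ‖v p‖ ^ 2) (d.φ₁, d.φ₂) :=
    ((hu.norm).pow 2).add ((hv.norm).pow 2)
  -- the neighbourhood of `(φ₁, φ₂)` where everything works
  have h1 : ∀ᶠ p in 𝓝 (d.φ₁, d.φ₂), ‖u p‖ ^ 2 + ‖v p‖ ^ 2 < d.κ₁⁻¹ + d.κ₂⁻¹ + ε := by
    refine hF.eventually_lt_const ?_
    show ‖u (d.φ₁, d.φ₂)‖ ^ 2 + ‖v (d.φ₁, d.φ₂)‖ ^ 2 < d.κ₁⁻¹ + d.κ₂⁻¹ + ε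
    rw [hu₀, hv₀, d.norm_φ₁_sq, d.norm_φ₂_sq]
    linarith
  have h2 : ∀ᶠ p in 𝓝 (d.φ₁, d.φ₂), ι p.1 ≠ 0 := by
    have hG : ContinuousAt (fun p : Q × Q => ‖ι p.1‖) (d.φ₁, d.φ₂) :=
      (ι.continuous.norm.continuousAt).comp_of_eq continuousAt_fst rfl
    have hval : (1 / 2 : ℝ) < ‖ι (d.φ₁, d.φ₂).1‖ := by rw [d.norm_map_φ₁]; norm_num
    refine (hG.eventually_const_lt hval).mono fun p hp h0 => ?_
    rw [h0, norm_zero] at hp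
    linarith
  have h3 : ∀ᶠ p in 𝓝 (d.φ₁, d.φ₂), ι (w p) ≠ 0 := by
    have hG : ContinuousAt (fun p : Q × Q => ‖ι (w p)‖) (d.φ₁, d.φ₂) :=
      (ι.continuous.norm.continuousAt).comp_of_eq hw rfl
    have hval : (1 / 2 : ℝ) < ‖ι (w (d.φ₁, d.φ₂))‖ := by rw [hw₀, d.norm_map_φ₂]; norm_num
    refine (hG.eventually_const_lt hval).mono fun p hp h0 => ?_
    rw [h0, norm_zero] at hp
    linarith
  have hdense : Dense ((S : Set Q) ×ˢ (S : Set Q)) := hS.prod hS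
  obtain ⟨p, ⟨hp1, hp2⟩, hlt, hne1, hne2⟩ := hdense.inter_nhds_nonempty (h1.and (h2.and h3))
  -- the output pair
  have huS : u p ∈ S := mapNormalize_mem ι hp1
  have hwS : w p ∈ S := S.sub_mem hp2 (S.smul_mem _ huS)
  have hun : ‖ι (u p)‖ = 1 := norm_map_mapNormalize ι hne1
  have horth : ⟪ι (u p), ι (w p)⟫_𝕜 = 0 := by
    simp only [hw_def, map_sub, map_smul, inner_sub_right, inner_smul_right,
      inner_self_eq_norm_sq_to_K, hun]
    simp
  refine ⟨u p, huS, v p, mapNormalize_mem ι hwS, hun, norm_map_mapNormalize ι hne2, ?_, hlt⟩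
  simp only [hv_def, mapNormalize, map_smul, inner_smul_right, horth, mul_zero]

/-- **Ky Fan's minimum principle over a form core (`m = 2`)**: for every dense subspace `S ⊆ Q`,
`κ₁⁻¹ + κ₂⁻¹ = inf {‖ψ₁‖²_Q + ‖ψ₂‖²_Q : ψᵢ ∈ S, ιψ₁, ιψ₂ orthonormal in H}` — the sum of the two
lowest eigenvalues of the operator of a closed semibounded form with compact resolvent is the
infimum of `q(ψ₁) + q(ψ₂)` over orthonormal pairs in any form core (shift by `2c` understood)
[ReedSimonIV1978, Thm. XIII.1–2; Ky Fan 1949, Thm. 1]. This is the abstract content of the min–max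
step [BoccatoEtAl2019Acta, §6] for `m = 2`. [folklore] -/
theorem isGLB_pair_of_dense {S : Submodule 𝕜 Q} (hS : Dense (S : Set Q)) :
    IsGLB {r : ℝ | ∃ ψ₁ ∈ S, ∃ ψ₂ ∈ S, ‖ι ψ₁‖ = 1 ∧ ‖ι ψ₂‖ = 1 ∧ ⟪ι ψ₁, ι ψ₂⟫_𝕜 = 0 ∧
      r = ‖ψ₁‖ ^ 2 + ‖ψ₂‖ ^ 2} (d.κ₁⁻¹ + d.κ₂⁻¹) := by
  refine ⟨?_, fun b hb => ?_⟩
  · rintro r ⟨ψ₁, -, ψ₂, -, h₁, h₂, h₁₂, rfl⟩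
    exact d.kyFan_two_le h₁ h₂ h₁₂
  · by_contra hlt
    push Not at hlt
    obtain ⟨ψ₁, h₁S, ψ₂, h₂S, h₁, h₂, h₁₂, hlt'⟩ := d.exists_pair_lt_of_dense hS (sub_pos.2 hlt)
    have := hb ⟨ψ₁, h₁S, ψ₂, h₂S, h₁, h₂, h₁₂, rfl⟩
    linarith

/-- The whole form domain is a form core: `κ₁⁻¹ + κ₂⁻¹` is the infimum of `‖ψ₁‖²_Q + ‖ψ₂‖²_Q` over
all `H`-orthonormal pairs in `Q`, and it is attained (`kyFan_two_attained`). [folklore] -/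
theorem isGLB_pair :
    IsGLB {r : ℝ | ∃ ψ₁ ψ₂ : Q, ‖ι ψ₁‖ = 1 ∧ ‖ι ψ₂‖ = 1 ∧ ⟪ι ψ₁, ι ψ₂⟫_𝕜 = 0 ∧
      r = ‖ψ₁‖ ^ 2 + ‖ψ₂‖ ^ 2} (d.κ₁⁻¹ + d.κ₂⁻¹) := by
  refine ⟨?_, fun b hb => ?_⟩
  · rintro r ⟨ψ₁, ψ₂, h₁, h₂, h₁₂, rfl⟩
    exact d.kyFan_two_le h₁ h₂ h₁₂
  · obtain ⟨h₁, h₂, h₁₂, hsum⟩ := d.kyFan_two_attained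
    exact hb ⟨d.φ₁, d.φ₂, h₁, h₂, h₁₂, hsum.symm⟩

end TwoModeData


end Literature.Analysis.InnerProduct
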